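import Literature.NumberTheory.EllipticCurves.Wuthrich2014.RankOneConverseProofs
import Literature.NumberTheory.EllipticCurves.Rank1Residual.Typed.X1
import Literature.NumberTheory.EllipticCurves.GreenbergVatsal2000.IwasawaInvariants
import HarnessLib

/-!
# Class X1 (Eisenstein ANOMALOUS good `p`), analytic rank ONE at `p ≥ 5`: what the published record gives
# modulo the Schneider certificate — and the sub-class B1 (`gvpar`) closed modulo that certificate

HONEST FRAMING (cell `b2b-bsdres`, home `run/shared/lean/b2b/bsd-rank1-residual/`, unit
`b2b-bsdres-x1b`, prover B, GEN 3, independent patchwork — NO Keller–Yin input): the cell deletes the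
COMBINATION-SHAPED residual classes of the rank-`≤ 1` BSD formula STRICTLY from published theorems and
TYPES the remainder; this is not "finishing BSD". Companion of `Rank1Residual/ClassX1.lean` (gen 1:
rank `0` closed on the sub-class `p ∤ #Ш(E')_an`; rank `1` certificate form `Ш[p^∞] = 0 ∧ p ∤ #Ш_an`),
`Rank1Residual/X1MainConjecture.lean` (gen 2: on X1 ∩ {r = 0}, Mazur's main conjecture ⟺ `BSD(E,p)`)
and `Rank1Residual/Typed/X1.lean` (the typed residual `X1.MissingInputAt`).

**Rank one, `p ≥ 5`, modulo ONE per-curve certificate.** The certificate is Schneider's non-degeneracy of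
THE canonical cyclotomic `p`-adic height on `E(ℚ)` (`SchneiderConjecture Dh` for the canonical `Dh`;
⟺ `[T¹]L_p(E,T) ≠ 0`, `Wuthrich2014.coeff_one_padicLFunction_ne_zero_iff_schneider`; a finite `p`-adic
computation certifies it when it holds — Stein–Wuthrich 2013 §§3–4; conjecturally always, Schneider
1985; known for CM curves only, Bertrand 1982). Granted it, and the PUBLISHED named facts Wuthrich 2014
Thm. 16 (`hW16`), Perrin-Riou–Schneider = Balakrishnan–Müller–Stein 2016 Thm. 1.7 (`hS`), Perrin-Riou
1987 §1.4 (`hPR`), Greenberg–Vatsal 2000 Thm. 1.3 (`hGV`), modularity (`hmod`), Gross–Zagier–Kolyvagin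
(`hGZK`), at an X1 pair `(E,p)` with `p ≥ 5` and `ord_{s=1} L(E,s) = 1`:

* `X1.missingUpperBoundAt_of_rank_one` — `ord_p #Ш(E/ℚ) ≤ ord_p #Ш(E/ℚ)_an` (the rank-one Wuthrich
  half; class-wide modulo the certificate);
* `X1.mainConjecture_iff_bsdp_of_rank_one`, `X1.mainConjecture_iff_missingInputAt_of_rank_one` — Mazur's
  main conjecture for `(E,p)` (body of prover A's `MazurMainConjecture W p`) ⟺ `BSDp W p` ⟺ the typed
  residual `Typed.X1.MissingInputAt W p`: gen 2's rank-`0` identification extends to rank `1`;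
* `bsdp_of_gvPar_of_analyticRank_eq_one` / `X1.bsdp_of_gvPar_of_rank_one` — **the sub-class
  B1 := X1 ∧ {r = 1} ∧ gvpar is CLOSED at `p ≥ 5` modulo the certificate**: Greenberg–Vatsal give the
  main conjecture outright under (GV) (no rank hypothesis), and main conjecture + Perrin-Riou–Schneider +
  Perrin-Riou + GZK give `ord_p #Ш_an = ord_p #Ш` (`missingPPartAt_of_mainConjecture_of_rank_one`, no
  Wuthrich input). Prover A's route to B1 needs the Keller–Yin preprint AND Mazur's main conjecture for
  the type-A twist partner (unstated in print); this route needs neither — its only non-published input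
  is the per-curve certificate;
* `X1.bsdp_and_mainConjecture_of_rank_one_of_shaAn_unit` — at an X1 pair with `p ∤ #Ш(E/ℚ)_an` (all 259
  rank-one census pairs of the v3 table, `N < 10⁴`; in prover A's table 38 rank-one X1 pairs with
  `N < 10⁴` and 71 with `N < 2·10⁴` are at `p ≥ 5`) the certificate yields `BSD(E,p)` AND Mazur's
  main conjecture for `(E,p)`: the lane's per-curve lever becomes the `p`-adic computation
  `[T¹]L_p(E,T) ≠ 0` instead of a `p`-isogeny descent.

Census pointer (not a verdict; prover A's exact parity census `x1_gvtype_classes_j041378.tsv`,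
X1-CENSUS-g2.md): the rank-one X1 pairs of parity type B (`gvpar`) at `p ≥ 5` are `726e1@5`, `2288e1@5`,
`5766g1@5`, `6448i1@5`, `7942g1@7` (`N < 10⁴`) and `12482g1@5`, `14883j1@5`, `15138t1@7`, `16606g1@5`,
`18352i1@5` (`N < 2·10⁴`) — the census members of B1 ∧ p ≥ 5; the class statement is what matters here.
Not covered: `p = 3` (381 type-A + 15 type-B of the 434 rank-one pairs with `N < 10⁴`; the tree's height /
Perrin-Riou–Schneider / Perrin-Riou facts carry `5 ≤ p`).

References: [Wuthrich2014] Thm. 16, §6; [PerrinRiou1987] §1.4 Cor. 1.8; [BalakrishnanMullerStein2015]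
Thm. 1.7; [GreenbergVatsal2000] Thm. (1.3); [SteinWuthrich2013] §§3–4, §9; [Miller2011LMS] Def. 1.1.
-/

set_option autoImplicit false

noncomputable section

open scoped Classical MatrixGroups ModularForm

open CongruenceSubgroup WeierstrassCurve Literature.NumberTheory.EllipticCurves
  Literature.NumberTheory.EllipticCurves.ModularForms
  Literature.NumberTheory.EllipticCurves.Wuthrich2014
  Literature.NumberTheory.EllipticCurves.Rank1Residual.Typed

namespace Literature.NumberTheory.EllipticCurves.Rank1Residual

/-! ### The parity sub-class (GV): main conjecture in print ⟹ `BSD(E,p)` modulo the certificate -/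

/-- **Rank one under the Greenberg–Vatsal parity condition: `BSD(E,p)` modulo the Schneider
certificate.** For `W/ℚ` globally minimal elliptic, `p ≥ 5` good ordinary with `GVPar W p` (some
rational `p`-isogeny kernel ramified-even or unramified-odd — in particular `E[p]` reducible),
`ord_{s=1} L(E,s) = 1`, and Schneider's non-degeneracy for the canonical `p`-adic height (`hSch`):
Miller's `BSDp W p`. Chain: Greenberg–Vatsal 2000 Thm. 1.3 (+ Kato) gives Mazur's main conjecture for
`(E,p)` (`hGV`, no rank hypothesis); `missingPPartAt_of_mainConjecture_of_rank_one` (Perrin-Riou–Schneider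
`hS`, Perrin-Riou 1987 `hPR`, modularity `hmod`, GZK `hGZK`) gives `ord_p #Ш_an = ord_p #Ш`; Miller's
remaining clauses are GZK. No Wuthrich and no Keller–Yin input. [cite: GreenbergVatsal2000, Thm. (1.3)]
[cite: PerrinRiou1987, §1.4 Cor. 1.8] [cite: BalakrishnanMullerStein2015, Thm. 1.7]
[cite: Miller2011LMS, Def. 1.1 (arXiv:1010.2431 p. 3)] -/
theorem bsdp_of_gvPar_of_analyticRank_eq_one (hGV : GreenbergVatsal2000.thm13_charIdeal_eq_of_gvPar)
    (hS : Schneider1985_order_charGenerator) (hPR : perrinRiou_rankOne_leadingTerms)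
    (hmod : nonempty_modularParametrizationData)
    (hGZK : rank_eq_analyticRank_of_analyticRank_le_one)
    (W : WeierstrassCurve ℚ) [W.IsElliptic] [W.IsGloballyMinimal] (p : ℕ) [Fact p.Prime]
    (hp : 5 ≤ p) (hgood : W.HasGoodReductionAtPrime p) (hordp : ¬ (p : ℤ) ∣ W.frobeniusTrace p)
    (hpar : GVPar W p) (han : W.analyticRank = 1)
    (hSch : ∀ Dh : PAdicHeightData W p, Dh.IsCanonical → SchneiderConjecture Dh) : BSDp W p :=
  bsdp_of_missingPPartAt W p hGZK han.le
    (missingPPartAt_of_mainConjecture_of_rank_one hS hPR hmod hGZK W p hp hgood hordp han hSch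
      (hGV W p (by omega) hgood hordp hpar))

/-! ### Class X1, analytic rank one, `p ≥ 5` -/

/-- **X1 ∩ {r = 1}, `p ≥ 5`: the published half `ord_p #Ш(E/ℚ) ≤ ord_p #Ш(E/ℚ)_an`** modulo the
Schneider certificate (Wuthrich Thm. 16 + Perrin-Riou–Schneider + Perrin-Riou + modularity + GZK;
`Wuthrich2014.missingUpperBoundAt_of_rank_one` on the class: good, ordinary since anomalous, reducible).
[cite: Wuthrich2014, Thm. 16 (p. 393) and §6 (p. 400)] [cite: PerrinRiou1987, §1.4 Cor. 1.8] -/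
theorem X1.missingUpperBoundAt_of_rank_one (hW16 : charIdeal_dvd_padicLFunction)
    (hS : Schneider1985_order_charGenerator) (hPR : perrinRiou_rankOne_leadingTerms)
    (hmod : nonempty_modularParametrizationData)
    (hGZK : rank_eq_analyticRank_of_analyticRank_le_one)
    (W : WeierstrassCurve ℚ) [W.IsElliptic] [W.IsGloballyMinimal] (p : ℕ) [Fact p.Prime]
    (hX1 : ClassX1 W p) (hp : 5 ≤ p) (han : W.analyticRank = 1)
    (hSch : ∀ Dh : PAdicHeightData W p, Dh.IsCanonical → SchneiderConjecture Dh) :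
    MissingUpperBoundAt W p :=
  have hX := isClassX1_of_classX1 hX1
  Wuthrich2014.missingUpperBoundAt_of_rank_one hW16 hS hPR hmod hGZK W p hp hX.hasGoodReductionAtPrime
    hX.not_dvd_frobeniusTrace hX.not_hasIrreducibleModPGaloisRep han hSch

/-- **X1 ∩ {r = 1}, `p ≥ 5`: Mazur's main conjecture for `(E,p)` ⟺ Miller's `BSD(E,p)`** modulo the
Schneider certificate, granted Wuthrich Thm. 16, Perrin-Riou–Schneider, Perrin-Riou 1987, modularity and
GZK — gen 2's rank-`0` identification (`X1.mainConjecture_iff_bsdp`) carried to rank `1`. The left side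
is literally the body of prover A's `MazurMainConjecture W p`. [cite: Wuthrich2014, Thm. 16 and §6]
[cite: PerrinRiou1987, §1.4 Cor. 1.8] [cite: BalakrishnanMullerStein2015, Thm. 1.7] -/
theorem X1.mainConjecture_iff_bsdp_of_rank_one (hW16 : charIdeal_dvd_padicLFunction)
    (hS : Schneider1985_order_charGenerator) (hPR : perrinRiou_rankOne_leadingTerms)
    (hmod : nonempty_modularParametrizationData)
    (hGZK : rank_eq_analyticRank_of_analyticRank_le_one)
    (W : WeierstrassCurve ℚ) [W.IsElliptic] [W.IsGloballyMinimal] (p : ℕ) [Fact p.Prime]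
    (hX1 : ClassX1 W p) (hp : 5 ≤ p) (han : W.analyticRank = 1)
    (hSch : ∀ Dh : PAdicHeightData W p, Dh.IsCanonical → SchneiderConjecture Dh) :
    (∀ (κ : ZpExtension ℚ p) (γ : Field.absoluteGaloisGroup ℚ),
        κ.IsCyclotomic → κ.IsTopGenerator γ → IsCyclotomicVariable p γ →
      ∀ [NeZero (W.conductorNorm ℤ)] (f : CuspForm (Gamma0 (W.conductorNorm ℤ)) 2),
        IsNewformOf W f → ∀ (ϖ : ℚ), (ϖ : ℝ) * W.realPeriodRat = plusPeriod f →
      ∀ (D : W.SelmerDualData κ γ), D.IsTorsion ∧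
        ∃ g : IwasawaAlgebra p, D.charIdeal = Ideal.span {g} ∧
          iwasawaToPowerSeries p g =
            PowerSeries.C (ϖ : ℚ_[p]) * padicLFunction f (unitRoot W p : ℚ_[p])) ↔
    BSDp W p :=
  have hX := isClassX1_of_classX1 hX1
  Wuthrich2014.mainConjecture_iff_bsdp_of_rank_one hW16 hS hPR hmod hGZK W p hp
    hX.hasGoodReductionAtPrime hX.not_dvd_frobeniusTrace hX.not_hasIrreducibleModPGaloisRep han hSch

/-- **X1 ∩ {r = 1}, `p ≥ 5`: prover A's typed input ⟺ prover B's typed residual**, modulo the Schneider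
certificate: Mazur's main conjecture for `(E,p)` holds iff `Typed.X1.MissingInputAt W p` (whose rank-one
clause is `MissingPPartAt W p`; the rank-zero clause is vacuous here). Same facts.
[cite: Wuthrich2014, Thm. 16 and §6] [cite: PerrinRiou1987, §1.4 Cor. 1.8] -/
theorem X1.mainConjecture_iff_missingInputAt_of_rank_one (hW16 : charIdeal_dvd_padicLFunction)
    (hS : Schneider1985_order_charGenerator) (hPR : perrinRiou_rankOne_leadingTerms)
    (hmod : nonempty_modularParametrizationData)
    (hGZK : rank_eq_analyticRank_of_analyticRank_le_one)
    (W : WeierstrassCurve ℚ) [W.IsElliptic] [W.IsGloballyMinimal] (p : ℕ) [Fact p.Prime]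
    (hX1 : ClassX1 W p) (hp : 5 ≤ p) (han : W.analyticRank = 1)
    (hSch : ∀ Dh : PAdicHeightData W p, Dh.IsCanonical → SchneiderConjecture Dh) :
    (∀ (κ : ZpExtension ℚ p) (γ : Field.absoluteGaloisGroup ℚ),
        κ.IsCyclotomic → κ.IsTopGenerator γ → IsCyclotomicVariable p γ →
      ∀ [NeZero (W.conductorNorm ℤ)] (f : CuspForm (Gamma0 (W.conductorNorm ℤ)) 2),
        IsNewformOf W f → ∀ (ϖ : ℚ), (ϖ : ℝ) * W.realPeriodRat = plusPeriod f →
      ∀ (D : W.SelmerDualData κ γ), D.IsTorsion ∧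
        ∃ g : IwasawaAlgebra p, D.charIdeal = Ideal.span {g} ∧
          iwasawaToPowerSeries p g =
            PowerSeries.C (ϖ : ℚ_[p]) * padicLFunction f (unitRoot W p : ℚ_[p])) ↔
    X1.MissingInputAt W p := by
  have hX := isClassX1_of_classX1 hX1
  rw [Wuthrich2014.mainConjecture_iff_missingPPartAt_of_rank_one hW16 hS hPR hmod hGZK W p hp
    hX.hasGoodReductionAtPrime hX.not_dvd_frobeniusTrace hX.not_hasIrreducibleModPGaloisRep han hSch]
  constructor
  · intro h
    exact ⟨fun h0 ↦ absurd (h0.symm.trans han) zero_ne_one, fun _ ↦ h⟩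
  · intro h
    exact h.2 han

/-- **B1 := X1 ∧ {r = 1} ∧ gvpar is closed at `p ≥ 5` modulo the Schneider certificate** (no
Keller–Yin, no partner main conjecture): `ClassX1 W p`, `5 ≤ p`, `ord_{s=1} L(E,s) = 1`, `GVPar W p`
and the certificate give `BSDp W p`, from Greenberg–Vatsal 2000 Thm. 1.3 (`hGV`), Perrin-Riou–Schneider
(`hS`), Perrin-Riou 1987 (`hPR`), modularity (`hmod`), GZK (`hGZK`) — all PUBLISHED.
(`bsdp_of_gvPar_of_analyticRank_eq_one`; on X1 good and ordinary are class clauses.)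
[cite: GreenbergVatsal2000, Thm. (1.3)] [cite: PerrinRiou1987, §1.4 Cor. 1.8]
[cite: BalakrishnanMullerStein2015, Thm. 1.7] [cite: Miller2011LMS, Def. 1.1 (arXiv:1010.2431 p. 3)] -/
theorem X1.bsdp_of_gvPar_of_rank_one (hGV : GreenbergVatsal2000.thm13_charIdeal_eq_of_gvPar)
    (hS : Schneider1985_order_charGenerator) (hPR : perrinRiou_rankOne_leadingTerms)
    (hmod : nonempty_modularParametrizationData)
    (hGZK : rank_eq_analyticRank_of_analyticRank_le_one)
    (W : WeierstrassCurve ℚ) [W.IsElliptic] [W.IsGloballyMinimal] (p : ℕ) [Fact p.Prime]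
    (hX1 : ClassX1 W p) (hp : 5 ≤ p) (han : W.analyticRank = 1) (hpar : GVPar W p)
    (hSch : ∀ Dh : PAdicHeightData W p, Dh.IsCanonical → SchneiderConjecture Dh) : BSDp W p :=
  have hX := isClassX1_of_classX1 hX1
  bsdp_of_gvPar_of_analyticRank_eq_one hGV hS hPR hmod hGZK W p hp hX.hasGoodReductionAtPrime
    hX.not_dvd_frobeniusTrace hpar han hSch

/-- **On B1 ∧ p ≥ 5 the typed residual `X1.MissingInputAt` is inhabited modulo the certificate** (from
`X1.bsdp_of_gvPar_of_rank_one` and `missingPPartAt_of_bsdp`; `Ш` finite by GZK).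
[cite: GreenbergVatsal2000, Thm. (1.3)] [cite: PerrinRiou1987, §1.4 Cor. 1.8] -/
theorem X1.missingInputAt_of_gvPar_of_rank_one (hGV : GreenbergVatsal2000.thm13_charIdeal_eq_of_gvPar)
    (hS : Schneider1985_order_charGenerator) (hPR : perrinRiou_rankOne_leadingTerms)
    (hmod : nonempty_modularParametrizationData)
    (hGZK : rank_eq_analyticRank_of_analyticRank_le_one)
    (W : WeierstrassCurve ℚ) [W.IsElliptic] [W.IsGloballyMinimal] (p : ℕ) [Fact p.Prime]
    (hX1 : ClassX1 W p) (hp : 5 ≤ p) (han : W.analyticRank = 1) (hpar : GVPar W p)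
    (hSch : ∀ Dh : PAdicHeightData W p, Dh.IsCanonical → SchneiderConjecture Dh) :
    X1.MissingInputAt W p := by
  haveI : Finite W.sha := (hGZK W han.le).2
  exact ⟨fun h0 ↦ absurd (h0.symm.trans han) zero_ne_one, fun _ ↦ missingPPartAt_of_bsdp W p
    (X1.bsdp_of_gvPar_of_rank_one hGV hS hPR hmod hGZK W p hX1 hp han hpar hSch)⟩

/-- **X1 ∩ {r = 1}, `p ≥ 5`, `p ∤ #Ш(E/ℚ)_an`: the certificate yields `BSD(E,p)` AND Mazur's main
conjecture for `(E,p)`** (Wuthrich Thm. 16 + Perrin-Riou–Schneider + Perrin-Riou + modularity + GZK;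
`Wuthrich2014.bsdp_and_mainConjecture_of_rank_one_of_shaAn_unit` on the class). Every rank-one X1 census
pair of the cell's v3 table (`N < 10⁴`) has `p ∤ #Ш_an`; at those with `p ≥ 5` the per-curve lever is the
`p`-adic computation `[T¹]L_p(E,T) ≠ 0` (lane pointer, not a verdict).
[cite: Wuthrich2014, Thm. 16 and §6] [cite: PerrinRiou1987, §1.4 Cor. 1.8]
[cite: Miller2011LMS, Def. 1.1 (arXiv:1010.2431 p. 3)] -/
theorem X1.bsdp_and_mainConjecture_of_rank_one_of_shaAn_unit (hW16 : charIdeal_dvd_padicLFunction)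
    (hS : Schneider1985_order_charGenerator) (hPR : perrinRiou_rankOne_leadingTerms)
    (hmod : nonempty_modularParametrizationData)
    (hGZK : rank_eq_analyticRank_of_analyticRank_le_one)
    (W : WeierstrassCurve ℚ) [W.IsElliptic] [W.IsGloballyMinimal] (p : ℕ) [Fact p.Prime]
    (hX1 : ClassX1 W p) (hp : 5 ≤ p) (han : W.analyticRank = 1)
    (hSch : ∀ Dh : PAdicHeightData W p, Dh.IsCanonical → SchneiderConjecture Dh)
    (hunit : ∃ q : ℚ, shaAn W = (q : ℂ) ∧ padicValRat p q = 0) :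
    BSDp W p ∧
    (∀ (κ : ZpExtension ℚ p) (γ : Field.absoluteGaloisGroup ℚ),
        κ.IsCyclotomic → κ.IsTopGenerator γ → IsCyclotomicVariable p γ →
      ∀ [NeZero (W.conductorNorm ℤ)] (f : CuspForm (Gamma0 (W.conductorNorm ℤ)) 2),
        IsNewformOf W f → ∀ (ϖ : ℚ), (ϖ : ℝ) * W.realPeriodRat = plusPeriod f →
      ∀ (D : W.SelmerDualData κ γ), D.IsTorsion ∧
        ∃ g : IwasawaAlgebra p, D.charIdeal = Ideal.span {g} ∧
          iwasawaToPowerSeries p g =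
            PowerSeries.C (ϖ : ℚ_[p]) * padicLFunction f (unitRoot W p : ℚ_[p])) :=
  have hX := isClassX1_of_classX1 hX1
  Wuthrich2014.bsdp_and_mainConjecture_of_rank_one_of_shaAn_unit hW16 hS hPR hmod hGZK W p hp
    hX.hasGoodReductionAtPrime hX.not_dvd_frobeniusTrace hX.not_hasIrreducibleModPGaloisRep han hSch hunit

/-- **The certificate in the form the lane computes it.** At an X1 pair with `p ≥ 5` and
`ord_{s=1} L(E,s) = 1`: if `[T¹]L_p(f,α,T) ≠ 0` for SOME newform `f` of `E` (a `p`-adic `L`-series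
computation to finite precision), then Schneider's non-degeneracy holds for the canonical height
(`coeff_one_padicLFunction_ne_zero_iff_schneider`; Perrin-Riou `hPR`, GZK `hGZK`).
[cite: PerrinRiou1987, §1.4 Cor. 1.8] [cite: SteinWuthrich2013, §§3–4] -/
theorem X1.schneider_of_coeff_one_ne_zero (hPR : perrinRiou_rankOne_leadingTerms)
    (hGZK : rank_eq_analyticRank_of_analyticRank_le_one)
    (W : WeierstrassCurve ℚ) [W.IsElliptic] [W.IsGloballyMinimal] (p : ℕ) [Fact p.Prime]
    (hX1 : ClassX1 W p) (hp : 5 ≤ p) (han : W.analyticRank = 1) {N : ℕ} [NeZero N]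
    (f : CuspForm (Gamma0 N) 2) (hf : IsNewformOf W f)
    (hcoeff : PowerSeries.coeff 1 (padicLFunction f (unitRoot W p : ℚ_[p])) ≠ 0) :
    ∀ Dh : PAdicHeightData W p, Dh.IsCanonical → SchneiderConjecture Dh := by
  have hX := isClassX1_of_classX1 hX1
  intro Dh hDh
  exact (coeff_one_padicLFunction_ne_zero_iff_schneider hPR hGZK W p hp
    ⟨hX.hasGoodReductionAtPrime, hX.not_dvd_frobeniusTrace⟩ han Dh hDh f hf).mp hcoeff

/-! ### Canonical shape (appended, gen 3): `analyticRank ≤ 1 → ClassX1 W p → …` -/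

/-- **B1 in the canonical shape of the cell.** For every globally minimal elliptic `W/ℚ` and prime
`p ≥ 5` with `ord_{s=1} L(E,s) ≤ 1`, `ClassX1 W p` and `GVPar W p`: the class clause
`¬(r_an = 0 ∧ gvpar)` forces `r_an = 1`, so `X1.bsdp_of_gvPar_of_rank_one` gives Miller's `BSDp W p`
modulo the Schneider certificate (`hSch`), from Greenberg–Vatsal 2000 Thm. 1.3 (`hGV`),
Perrin-Riou–Schneider (`hS`), Perrin-Riou 1987 (`hPR`), modularity (`hmod`), GZK (`hGZK`) — all
PUBLISHED; no Keller–Yin input. [cite: GreenbergVatsal2000, Thm. (1.3)] [cite: PerrinRiou1987, §1.4 Cor. 1.8]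
[cite: BalakrishnanMullerStein2015, Thm. 1.7] [cite: Miller2011LMS, Def. 1.1 (arXiv:1010.2431 p. 3)] -/
theorem X1.bsdp_of_gvPar (hGV : GreenbergVatsal2000.thm13_charIdeal_eq_of_gvPar)
    (hS : Schneider1985_order_charGenerator) (hPR : perrinRiou_rankOne_leadingTerms)
    (hmod : nonempty_modularParametrizationData)
    (hGZK : rank_eq_analyticRank_of_analyticRank_le_one)
    (W : WeierstrassCurve ℚ) [W.IsElliptic] [W.IsGloballyMinimal] (p : ℕ) [Fact p.Prime]
    (hr : W.analyticRank ≤ 1) (hX1 : ClassX1 W p) (hpar : GVPar W p) (hp : 5 ≤ p)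
    (hSch : ∀ Dh : PAdicHeightData W p, Dh.IsCanonical → SchneiderConjecture Dh) : BSDp W p := by
  have han : W.analyticRank = 1 := by
    rcases Nat.le_one_iff_eq_zero_or_eq_one.mp hr with h0 | h1
    · exact absurd ⟨h0, hpar⟩ hX1.2.2.2.2
    · exact h1
  exact X1.bsdp_of_gvPar_of_rank_one hGV hS hPR hmod hGZK W p hX1 hp han hpar hSch

/-- **Canonical shape, both ranks, `p ≥ 5`, `p ∤ #Ш(E/ℚ)_an`:** for every globally minimal elliptic
`W/ℚ` and prime `p ≥ 5` with `ord_{s=1} L(E,s) ≤ 1`, `ClassX1 W p` and `#Ш(E/ℚ)_an` a rational of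
`p`-adic valuation `0`: `BSDp W p`, where in analytic rank `0` nothing more is needed (Wuthrich 2014
Prop. 21 `hW`, gen 1: `bsdp_of_classX1_of_L_one_ne_zero`) and in analytic rank `1` the Schneider
certificate is (`hSch`, used only when `r_an = 1`; gen 3: `X1.bsdp_and_mainConjecture_of_rank_one_of_shaAn_unit`
— Wuthrich Thm. 16 `hW16`, Perrin-Riou–Schneider `hS`, Perrin-Riou `hPR`, modularity `hmod`, GZK
`hGZK`). On the census every X1 pair has `p ∤ #Ш_an`; this is the one statement behind the lane levers
"T-WU14" (r = 0) and "p-adic certificate" (r = 1, p ≥ 5). [cite: Wuthrich2014, Thm. 16, §6 and Prop. 21]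
[cite: PerrinRiou1987, §1.4 Cor. 1.8] [cite: Miller2011LMS, Def. 1.1 (arXiv:1010.2431 p. 3)] -/
theorem X1.bsdp_of_shaAn_unit (hW : sha_dvd_analyticSha) (hW16 : charIdeal_dvd_padicLFunction)
    (hS : Schneider1985_order_charGenerator) (hPR : perrinRiou_rankOne_leadingTerms)
    (hmod : nonempty_modularParametrizationData)
    (hGZK : rank_eq_analyticRank_of_analyticRank_le_one)
    (W : WeierstrassCurve ℚ) [W.IsElliptic] [W.IsGloballyMinimal] (p : ℕ) [Fact p.Prime]
    (hr : W.analyticRank ≤ 1) (hX1 : ClassX1 W p) (hp : 5 ≤ p)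
    (hunit : ∃ q : ℚ, shaAn W = (q : ℂ) ∧ padicValRat p q = 0)
    (hSch : W.analyticRank = 1 → ∀ Dh : PAdicHeightData W p, Dh.IsCanonical → SchneiderConjecture Dh) :
    BSDp W p := by
  rcases Nat.le_one_iff_eq_zero_or_eq_one.mp hr with h0 | h1
  · haveI : NeZero (W.conductorNorm ℤ) := ⟨(W.conductorNorm_pos_holds).ne'⟩
    obtain ⟨Dm⟩ := hmod W
    exact bsdp_of_classX1_of_L_one_ne_zero hW hGZK W p hr hX1
      ((W.analyticRank_eq_zero_iff_holds Dm.isNewformOf.hasEntireLFunction).mp h0) hunit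
  · exact (X1.bsdp_and_mainConjecture_of_rank_one_of_shaAn_unit hW16 hS hPR hmod hGZK W p hX1 hp h1
      (hSch h1) hunit).1

end Literature.NumberTheory.EllipticCurves.Rank1Residual

end
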